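import Summits.Ventures.PercRepro.NullityCircuitsB

/-!
# PercRepro — Proposition C₀ (U): the rank-`q` sets of a simple matroid of bounded nullity (night-1, gen 0)

`proofs/NIGHT-1-C025-induction.md` §10, Proposition C₀ (U). In a finite matroid with `|E| = r(E) + d` whose circuits
all have `≥ 3` elements (simple: no loops, no parallel pairs):

* **`exists_circuit_extension_of_dense`** — a set `X` of rank `q` with more than `q` elements contains a circuit `C`
  with `|C| ≤ q + 1`, and there is `B' ⊆ X` with `|B'| ≤ q − 2` and `X ⊆ cl(C ∪ B')` (extend `C ∖ {c}` to a basis `B` of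
  `X`, put `B' = B ∖ C`); moreover `|cl(C ∪ B')| ≤ q + d`;
* **`ncard_eRk_eq_le`** — hence `#{X ⊆ E : r(X) = q} ≤ C(n, q) + #𝒞_{q+1} · (Σ_{j ≤ q−2} C(n, j)) · 2^{q+d}` where
  `𝒞_{q+1}` is the set of circuits with `≤ q + 1` elements (`circuitsLE`), itself of size `≤ 2^{(q+1)d}`
  (`ncard_circuitsLE_le`).
Axioms: standard.
-/

namespace PercRepro

namespace Matroid

open Set

variable {α : Type*} {M : _root_.Matroid α}

/-- **The structure of a dense rank-`q` set**: if every circuit of `M` has `≥ 3` elements, `X ⊆ E` has rank `q` and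
more than `q` elements, then some circuit `C ⊆ X` with `|C| ≤ q + 1` and some `B' ⊆ X` with `|B'| ≤ q − 2` satisfy
`X ⊆ cl(C ∪ B')`. -/
theorem exists_circuit_extension_of_dense [M.Finite] (hcirc : ∀ C, M.IsCircuit C → 3 ≤ C.encard)
    {X : Set α} (hX : X ⊆ M.E) {q : ℕ} (hq : M.eRk X = q) (hdense : (q : ℕ∞) < X.encard) :
    ∃ C B' : Set α, M.IsCircuit C ∧ C.encard ≤ q + 1 ∧ C ⊆ X ∧ B' ⊆ X ∧ B'.encard ≤ q - 2 ∧
      X ⊆ M.closure (C ∪ B') := by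
  have hXfin : X.Finite := M.ground_finite.subset hX
  -- `X` is dependent: an independent `X` would have `r(X) = |X| > q`
  have hdep : M.Dep X := by
    refine ⟨fun hind => ?_, hX⟩
    rw [hind.eRk_eq_encard] at hq
    rw [hq] at hdense
    exact lt_irrefl _ hdense
  obtain ⟨C, hCX, hC⟩ := hdep.exists_isCircuit_subset
  obtain ⟨c, hc⟩ := hC.nonempty
  -- `|C| = r(C) + 1 ≤ r(X) + 1 = q + 1`
  have hCcard : C.encard ≤ q + 1 := by
    rw [← hC.eRk_add_one_eq, ← hq]
    gcongr
    exact M.eRk_mono hCX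
  -- extend the independent set `C ∖ {c}` to a basis `B` of `X`
  have hind : M.Indep (C \ {c}) := hC.sdiff_singleton_indep hc
  obtain ⟨B, hB, hCB⟩ := hind.subset_isBasis_of_subset (sdiff_subset.trans hCX) hX
  have hBcard : B.encard = q := by rw [hB.encard_eq_eRk, hq]
  have hBfin : B.Finite := M.ground_finite.subset (hB.subset.trans hX)
  refine ⟨C, B \ C, hC, hCcard, hCX, sdiff_subset.trans hB.subset, ?_, ?_⟩
  · -- `|B ∖ C| = |B| − |B ∩ C| ≤ q − (|C| − 1) ≤ q − 2`
    have h1 : (B ∩ C).encard + (B \ C).encard = B.encard := by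
      rw [add_comm]; exact encard_sdiff_add_encard_inter B C
    have h2 : (C \ {c}).encard ≤ (B ∩ C).encard :=
      encard_le_encard (subset_inter hCB sdiff_subset)
    have h3 : (C \ {c}).encard + 1 = C.encard := encard_sdiff_singleton_add_one hc
    have h4 : (3 : ℕ∞) ≤ C.encard := hcirc C hC
    have h5 : (2 : ℕ∞) ≤ (C \ {c}).encard := by
      have : (2 : ℕ∞) + 1 ≤ (C \ {c}).encard + 1 := by rw [h3]; exact h4
      exact (WithTop.add_le_add_iff_right (WithTop.one_ne_top)).1 this
    -- now `(B ∖ C).encard + 2 ≤ (B ∖ C).encard + (B ∩ C).encard = |B| = q`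
    have h6 : (B \ C).encard + 2 ≤ (q : ℕ∞) := by
      calc (B \ C).encard + 2 ≤ (B \ C).encard + (B ∩ C).encard := by gcongr; exact h5.trans h2
        _ = B.encard := by rw [add_comm]; exact h1
        _ = q := hBcard
    have hfin' : (B \ C).Finite := hBfin.subset sdiff_subset
    rw [← hfin'.cast_ncard_eq] at h6 ⊢
    have h6' : (B \ C).ncard + 2 ≤ q := by exact_mod_cast h6
    exact_mod_cast (Nat.le_sub_of_add_le h6')
  · -- `X ⊆ cl(B) ⊆ cl(C ∪ (B ∖ C))`
    have hBsub : B ⊆ C ∪ (B \ C) := by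
      intro x hx
      by_cases hxC : x ∈ C
      · exact Or.inl hxC
      · exact Or.inr ⟨hx, hxC⟩
    exact hB.subset_closure.trans (M.closure_subset_closure hBsub)

/-- The subsets of a finite set `T` (as a `Finset` of `Set`s): `((T.toFinset.powerset).image coe)`; a set `Z ⊆ T` is
a member. -/
theorem mem_powersetSets {T : Set α} (hT : T.Finite) {Z : Set α} (hZ : Z ⊆ T) :
    Z ∈ (hT.toFinset.powerset.image (fun s : Finset α => (s : Set α))) := by
  classical
  have hZfin : Z.Finite := hT.subset hZ
  rw [Finset.mem_image]
  refine ⟨hZfin.toFinset, ?_, by simp⟩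
  rw [Finset.mem_powerset]
  intro x hx
  rw [Set.Finite.mem_toFinset] at hx ⊢
  exact hZ hx

/-- `#{subsets of T} ≤ 2^{|T|}` in `Finset` form. -/
theorem card_powersetSets_le {T : Set α} (hT : T.Finite) :
    (hT.toFinset.powerset.image (fun s : Finset α => (s : Set α))).card ≤ 2 ^ T.ncard := by
  classical
  calc (hT.toFinset.powerset.image (fun s : Finset α => (s : Set α))).card
      ≤ hT.toFinset.powerset.card := Finset.card_image_le
    _ = 2 ^ hT.toFinset.card := Finset.card_powerset _
    _ = 2 ^ T.ncard := by rw [Set.ncard_eq_toFinset_card T hT]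

/-- **Proposition C₀ (U)**: in a finite matroid with `|E| = r(E) + d` all of whose circuits have `≥ 3` elements,
`#{X ⊆ E : r(X) = q} ≤ C(n, q) + #𝒞_{q+1} · (Σ_{j ≤ q−2} C(n, j)) · 2^{q+d}` (`n = |E|`, `𝒞_{q+1} = circuitsLE M (q+1)`). -/
theorem ncard_eRk_eq_le [M.Finite] (hcirc : ∀ C, M.IsCircuit C → 3 ≤ C.encard) {q d : ℕ}
    (hd : M.E.encard = M.eRank + d) :
    {X : Set α | X ⊆ M.E ∧ M.eRk X = q}.ncard ≤
      M.ground_finite.toFinset.card.choose q +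
        (circuitsLE M (q + 1)).ncard *
          (∑ j ∈ Finset.range (q - 2 + 1), M.ground_finite.toFinset.card.choose j) * 2 ^ (q + d) := by
  classical
  set Ef := M.ground_finite.toFinset with hEf
  have hE : (Ef : Set α) = M.E := Set.Finite.coe_toFinset _
  have hfinS : {X : Set α | X ⊆ M.E ∧ M.eRk X = q}.Finite :=
    M.ground_finite.finite_subsets.subset (fun X hX => hX.1)
  -- split by size
  set S₁ := {X : Set α | X ⊆ M.E ∧ M.eRk X = q ∧ X.ncard = q} with hS₁
  set S₂ := {X : Set α | X ⊆ M.E ∧ M.eRk X = q ∧ q < X.ncard} with hS₂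
  have hsplit : {X : Set α | X ⊆ M.E ∧ M.eRk X = q} ⊆ S₁ ∪ S₂ := by
    intro X hX
    have hXfin : X.Finite := M.ground_finite.subset hX.1
    have hle : q ≤ X.ncard := by
      have := M.eRk_le_encard X
      rw [hX.2, ← hXfin.cast_ncard_eq] at this
      exact_mod_cast this
    rcases hle.lt_or_eq with h | h
    · exact Or.inr ⟨hX.1, hX.2, h⟩
    · exact Or.inl ⟨hX.1, hX.2, h.symm⟩
  have hS₁fin : S₁.Finite := hfinS.subset (fun X hX => ⟨hX.1, hX.2.1⟩)
  have hS₂fin : S₂.Finite := hfinS.subset (fun X hX => ⟨hX.1, hX.2.1⟩)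
  -- `S₁`: at most `C(n, q)`
  have hS₁ : S₁.ncard ≤ Ef.card.choose q := by
    rw [← ncard_subsets_ncard_eq Ef q]
    apply Set.ncard_le_ncard
    · intro X hX; exact ⟨by rw [hE]; exact hX.1, hX.2.2⟩
    · exact (Ef.finite_toSet.finite_subsets).subset (fun X hX => hX.1)
  -- `S₂`: the injection into the pairs `(C, B')` with the subsets of `cl(C ∪ B')`
  set 𝒞f := (circuitsLE_finite (M := M) (q + 1)).toFinset with h𝒞f
  set 𝓑f := ((Ef.powerset.filter (fun s : Finset α => s.card ≤ q - 2)).image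
    (fun s : Finset α => (s : Set α))) with h𝓑f
  have h𝓑set : (𝓑f : Set (Set α)) = {X : Set α | X ⊆ (Ef : Set α) ∧ X.ncard ≤ q - 2} := by
    ext X
    simp only [h𝓑f, Finset.coe_image, Finset.coe_filter, Set.mem_image, Set.mem_setOf_eq,
      Finset.mem_powerset, Set.mem_setOf_eq]
    constructor
    · rintro ⟨s, ⟨hsE, hs⟩, rfl⟩
      exact ⟨Finset.coe_subset.2 hsE, by rw [Set.ncard_coe_finset]; exact hs⟩
    · rintro ⟨hXE, hX⟩
      have hXfin : X.Finite := Ef.finite_toSet.subset hXE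
      refine ⟨hXfin.toFinset, ⟨?_, ?_⟩, by simp⟩
      · intro x hx
        rw [Set.Finite.mem_toFinset] at hx
        exact Finset.mem_coe.1 (hXE hx)
      · rw [← Set.ncard_eq_toFinset_card X hXfin]; exact hX
  have h𝓑card : 𝓑f.card ≤ ∑ j ∈ Finset.range (q - 2 + 1), Ef.card.choose j := by
    have := ncard_subsets_ncard_le Ef (q - 2)
    rw [← h𝓑set, Set.ncard_coe_finset] at this
    exact this
  -- the pairs with `r(C ∪ B') ≤ q`, and the fibres
  set P := (𝒞f ×ˢ 𝓑f).filter (fun p : Set α × Set α => M.eRk (p.1 ∪ p.2) ≤ q) with hP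
  have hclfin : ∀ p : Set α × Set α, (M.closure (p.1 ∪ p.2)).Finite :=
    fun p => M.ground_finite.subset (M.closure_subset_ground _)
  set Tf : Finset (Set α × Set α × Set α) := P.biUnion (fun p =>
    ((hclfin p).toFinset.powerset.image (fun s : Finset α => (s : Set α))).image
      (fun Z => (p.1, p.2, Z))) with hTf
  -- every dense `X` lands in `Tf`
  have hex : ∀ X ∈ S₂, ∃ p : Set α × Set α, p ∈ P ∧ (p.1, p.2, X) ∈ Tf := by
    intro X hX
    obtain ⟨C, B', hC, hCcard, hCX, hB'X, hB'card, hXcl⟩ :=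
      exists_circuit_extension_of_dense hcirc hX.1 hX.2.1 (by
        have hXfin : X.Finite := M.ground_finite.subset hX.1
        rw [← hXfin.cast_ncard_eq]; exact_mod_cast hX.2.2)
    have hB'fin : B'.Finite := M.ground_finite.subset (hB'X.trans hX.1)
    refine ⟨(C, B'), ?_, ?_⟩
    · rw [hP, Finset.mem_filter, Finset.mem_product]
      refine ⟨⟨?_, ?_⟩, ?_⟩
      · rw [h𝒞f, Set.Finite.mem_toFinset]; exact ⟨hC, hCcard⟩
      · rw [← Finset.mem_coe, h𝓑set]
        refine ⟨by rw [hE]; exact hB'X.trans hX.1, ?_⟩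
        rw [← hB'fin.cast_ncard_eq] at hB'card
        exact_mod_cast hB'card
      · calc M.eRk (C ∪ B') ≤ M.eRk X := M.eRk_mono (Set.union_subset hCX hB'X)
          _ = q := hX.2.1
    · rw [hTf, Finset.mem_biUnion]
      refine ⟨(C, B'), ?_, ?_⟩
      · rw [hP, Finset.mem_filter, Finset.mem_product]
        refine ⟨⟨?_, ?_⟩, ?_⟩
        · rw [h𝒞f, Set.Finite.mem_toFinset]; exact ⟨hC, hCcard⟩
        · rw [← Finset.mem_coe, h𝓑set]
          refine ⟨by rw [hE]; exact hB'X.trans hX.1, ?_⟩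
          rw [← hB'fin.cast_ncard_eq] at hB'card
          exact_mod_cast hB'card
        · calc M.eRk (C ∪ B') ≤ M.eRk X := M.eRk_mono (Set.union_subset hCX hB'X)
            _ = q := hX.2.1
      · rw [Finset.mem_image]
        exact ⟨X, mem_powersetSets (hclfin (C, B')) hXcl, rfl⟩
  -- the injection `X ↦ (C_X, B'_X, X)`
  let g : Set α → Set α × Set α × Set α := fun X =>
    if h : X ∈ S₂ then ((Classical.choose (hex X h)).1, (Classical.choose (hex X h)).2, X) else (∅, ∅, X)
  have hgmaps : ∀ X ∈ S₂, g X ∈ (Tf : Set (Set α × Set α × Set α)) := by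
    intro X hX
    simp only [g, dif_pos hX]
    exact (Classical.choose_spec (hex X hX)).2
  have hginj : Set.InjOn g S₂ := by
    intro X hX Y hY hXY
    simp only [g, dif_pos hX, dif_pos hY, Prod.mk.injEq] at hXY
    exact hXY.2.2
  have hS₂ : S₂.ncard ≤ Tf.card := by
    rw [← Set.ncard_coe_finset]
    exact Set.ncard_le_ncard_of_injOn g hgmaps hginj (Tf.finite_toSet)
  -- the size of `Tf`
  have hTfcard : Tf.card ≤ (circuitsLE M (q + 1)).ncard * (∑ j ∈ Finset.range (q - 2 + 1), Ef.card.choose j) *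
      2 ^ (q + d) := by
    calc Tf.card ≤ ∑ p ∈ P, (((hclfin p).toFinset.powerset.image (fun s : Finset α => (s : Set α))).image
          (fun Z => (p.1, p.2, Z))).card := Finset.card_biUnion_le
      _ ≤ ∑ p ∈ P, 2 ^ (q + d) := by
          apply Finset.sum_le_sum
          intro p hp
          rw [hP, Finset.mem_filter] at hp
          calc (((hclfin p).toFinset.powerset.image (fun s : Finset α => (s : Set α))).image
                (fun Z => (p.1, p.2, Z))).card
              ≤ ((hclfin p).toFinset.powerset.image (fun s : Finset α => (s : Set α))).card :=
                Finset.card_image_le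
            _ ≤ 2 ^ (M.closure (p.1 ∪ p.2)).ncard := card_powersetSets_le (hclfin p)
            _ ≤ 2 ^ (q + d) := by
                apply Nat.pow_le_pow_right (by norm_num)
                have h := encard_le_of_eRk_le (M.closure_subset_ground (p.1 ∪ p.2)) hd
                  (by rw [M.eRk_closure_eq]; exact hp.2)
                rw [← (hclfin p).cast_ncard_eq] at h
                exact_mod_cast h
      _ = P.card * 2 ^ (q + d) := by rw [Finset.sum_const, smul_eq_mul]
      _ ≤ (𝒞f ×ˢ 𝓑f).card * 2 ^ (q + d) := by
          have hPle : P.card ≤ (𝒞f ×ˢ 𝓑f).card := by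
            rw [hP]
            exact Finset.card_le_card (Finset.filter_subset (fun p : Set α × Set α => M.eRk (p.1 ∪ p.2) ≤ q) _)
          exact Nat.mul_le_mul_right _ hPle
      _ = 𝒞f.card * 𝓑f.card * 2 ^ (q + d) := by rw [Finset.card_product]
      _ ≤ (circuitsLE M (q + 1)).ncard * (∑ j ∈ Finset.range (q - 2 + 1), Ef.card.choose j) * 2 ^ (q + d) := by
          rw [h𝒞f, ← Set.ncard_eq_toFinset_card _ (circuitsLE_finite (q + 1))]
          gcongr
  calc {X : Set α | X ⊆ M.E ∧ M.eRk X = q}.ncard ≤ (S₁ ∪ S₂).ncard :=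
        Set.ncard_le_ncard hsplit (hS₁fin.union hS₂fin)
    _ ≤ S₁.ncard + S₂.ncard := Set.ncard_union_le _ _
    _ ≤ Ef.card.choose q + Tf.card := add_le_add hS₁ hS₂
    _ ≤ _ := by gcongr

end Matroid

end PercRepro
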